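import Mathlib
import HarnessLib
import Summits.HubbardSuperconductivity.HubbardSuperconductivity.Theorems.KLProgrammeKLRegimeEngineV8DefsG8
import Summits.HubbardSuperconductivity.HubbardSuperconductivity.Theorems.KLProgrammeKLRegimeEngineV8PairTransferExport

/-!
# Route `KLProgramme` — ENGINE child gen 8 (stmt-HubbardSuperconductivity-20437 `KLRegimeEngineV17F2`), skeleton v2 class #5 «(S)-transfer»: the transfer allowance
# `transferBarAt` is STRICTLY DECREASING in the scale over the head of the ladder — the kernel form of the located finding «CLASS5-COMPOSE-BUDGET»
# (HOME/p1/CLASS5-COMPOSE-BUDGET.md, evidence on 20437; cell gate-hubbard-kl, seat hubbard-kl-p1 g12)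

WHY.  The class-#5 producer door `pairTransferPinnedAt_succ` (p581707; ≡ `kltc_transfer_compose_fwd_on[_repin]` keyed) pays the history straddle `R′` and the plain-step error `E` with
coefficient `1`: its budget hypothesis needs `R′ + E + E_a ≤ transferBarAt … (n+1)` pointwise, and with the only history the v2 composition carries (`PairTransferPinnedAt … n`, same
package constant `r`) `R′ = transferBarAt … n`, so it needs `transferBarAt … n ≤ transferBarAt … (n+1)` at the same labels.  This file proves the OPPOSITE strict inequality over the head
of the ladder, for the geometry package of record:
* §1 `phGainOf_eq_one_of_le` — `phGainOf 2^24 2^24 2^24 2^24 0 e₀ n n ρ = 1` for every `ρ ≥ 0`, `n ≤ 12` (both inner majorants are `≥ 1`: `2^24·4^{−n} ≥ 1`, `2^24·√e₀·2^{−n} ≥ 1`);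
  **`klEngGeo8_phGain_eq_of_le`**: `klEngGeo8.phGain n ρ = 2^28` for every `ρ`, `n ≤ 12` — the ph-gain profile is FLAT there;
* §2 `thermalBar_succ_le` (`thermalBar … (n+1) ≤ 4·thermalBar … n`, ℕ-subtraction both sides), `thermalBar_succ_eq_of_le` (`= thermalBar n` past the last scale);
* §3 **`transferBarAt_succ_lt_klEngGeo8`**: `0 < r`, `n ≤ 11`, `3·thermalBar G P U β n < (P.Klam·|U|)³·2^{−(n+1)}` ⇒
  `transferBarAt L klEngGeo8 P r β U (n+1) Qm k k′ < transferBarAt L klEngGeo8 P r β U n Qm k k′` at EVERY `Qm k k′`;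
  **`transferBarAt_succ_lt_klEngGeo8_of_nScales_le`**: past the last scale (`nScales β ≤ n ≤ 11`, `0 < P.Klam·|U|`) UNCONDITIONALLY (the thermal term is constant there) — e.g. `β = klBetaMin`
  (`n_β = 0`): the allowance drops at the very first step; deep in the regime the hypothesis of the first form at `n = 0` reads `6·CF·4^{−n_β} < Klam·|U|`, true for `β` large.
Consequence (prose, memo §2–3): no package `(r,u)` lets the compose route witness `PairTransferStep3`; a cumulative allowance kills step 3 instead.  Pure arithmetic on landed
definitions; nothing about the model is asserted; nothing asserts superconductivity.  0 kit.
-/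

noncomputable section

namespace Summit.HubbardSuperconductivity.HubbardSuperconductivity.Theorems.KLRegimeSplit

set_option linter.dupNamespace false -- summit = problem name (single-conjunct summit), D-0017

open Real Finset Literature.MathematicalPhysics.QuantumLattice Literature.Probability.LatticeModels
open Summit.HubbardSuperconductivity.HubbardSuperconductivity.Theorems.KLProgrammeLegKernels
open Summit.HubbardSuperconductivity.HubbardSuperconductivity.Theorems.EngineV8

/-! ## §1 The ph-gain profile of the package of record is FLAT over the first twelve scales -/

/-- Both inner majorants of `phGainOf 2^24 2^24 2^24 2^24 0 e₀ n n ρ` are `≥ 1` for `n ≤ 12`, `ρ ≥ 0`, so the capped profile equals `1`. -/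
theorem phGainOf_eq_one_of_le {n : ℕ} (hn : n ≤ 12) {ρ : ℝ} (hρ : 0 ≤ ρ) :
    phGainOf (2 ^ 24) (2 ^ 24) (2 ^ 24) (2 ^ 24) 0 klE0 n n ρ = 1 := by
  unfold phGainOf
  have he₀ : (0 : ℝ) < klE0 := by norm_num [klE0]
  have h4 : (0 : ℝ) < (4 : ℝ) ^ n := by positivity
  have h2 : (0 : ℝ) < (2 : ℝ) ^ n := by positivity
  -- `2^24·4^{-n} ≥ 1` for `n ≤ 12`
  have h4le : (4 : ℝ) ^ n ≤ 2 ^ 24 := by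
    calc (4 : ℝ) ^ n ≤ 4 ^ 12 := pow_le_pow_right₀ (by norm_num) hn
      _ = 2 ^ 24 := by norm_num
  have hA : 1 ≤ (2 : ℝ) ^ 24 * ((4 : ℝ) ^ n)⁻¹ + 2 ^ 24 * (ρ + 0 * ((4 : ℝ) ^ n)⁻¹) / klE0 * (4 : ℝ) ^ n := by
    have h1 : 1 ≤ (2 : ℝ) ^ 24 * ((4 : ℝ) ^ n)⁻¹ := by
      rw [le_mul_inv_iff₀ h4, one_mul]; exact h4le
    have h2' : 0 ≤ 2 ^ 24 * (ρ + 0 * ((4 : ℝ) ^ n)⁻¹) / klE0 * (4 : ℝ) ^ n := by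
      simp only [zero_mul, add_zero]; positivity
    linarith
  -- `2^24·√e₀·2^{-n} ≥ 1` for `n ≤ 21 ⊇ n ≤ 12`
  have hsq : (1 : ℝ) / 8 ≤ Real.sqrt klE0 := by
    rw [show (1 : ℝ) / 8 = Real.sqrt ((1 / 8) ^ 2) by rw [Real.sqrt_sq (by norm_num)]]
    exact Real.sqrt_le_sqrt (by norm_num [klE0])
  have h2le : (2 : ℝ) ^ n ≤ 2 ^ 12 := pow_le_pow_right₀ (by norm_num) hn
  have hB : 1 ≤ (if 0 * ((4 : ℝ) ^ n)⁻¹ < ρ then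
      2 ^ 24 * (klE0 * ((4 : ℝ) ^ n)⁻¹) / (ρ - 0 * ((4 : ℝ) ^ n)⁻¹) + 2 ^ 24 * Real.sqrt klE0 * ((2 : ℝ) ^ n)⁻¹ else 1) := by
    split_ifs with h
    · simp only [zero_mul, sub_zero] at h ⊢
      have h1 : 0 ≤ 2 ^ 24 * (klE0 * ((4 : ℝ) ^ n)⁻¹) / ρ := by positivity
      have h3 : 1 ≤ 2 ^ 24 * Real.sqrt klE0 * ((2 : ℝ) ^ n)⁻¹ := by
        rw [le_mul_inv_iff₀ h2, one_mul]
        calc (2 : ℝ) ^ n ≤ 2 ^ 12 := h2le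
          _ ≤ 2 ^ 24 * (1 / 8) := by norm_num
          _ ≤ 2 ^ 24 * Real.sqrt klE0 := mul_le_mul_of_nonneg_left hsq (by positivity)
      linarith
    · exact le_rfl
  rw [min_eq_left (le_min hA hB)]

/-- **`klEngGeo8.phGain n ρ = 2^28` for every `ρ` and every `n ≤ 12`** (`= 2^28·phGainOf … (max ρ 0)` through the `rfl` rows G8 → G5). -/
theorem klEngGeo8_phGain_eq_of_le {n : ℕ} (hn : n ≤ 12) (ρ : ℝ) : klEngGeo8.phGain n ρ = 2 ^ 28 := by
  rw [klEngGeo8_phGain, klEngGeo7_phGain, klEngGeo6_phGain, klEngGeo5_phGain_apply, phGainOf_eq_one_of_le hn (le_max_right _ _), mul_one]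

/-! ## §2 The thermal term grows by at most a factor `4` per step, and is constant past the last scale -/

/-- `thermalBar … (n+1) ≤ 4·thermalBar … n` (`0 ≤ G.CF`; equality below the last scale, `≤` past it). -/
theorem thermalBar_succ_le {G : GeoConsts} (hCF : 0 ≤ G.CF) (P : SplitConsts) (U β : ℝ) (n : ℕ) :
    thermalBar G P U β (n + 1) ≤ 4 * thermalBar G P U β n := by
  unfold thermalBar
  have hc : 0 ≤ G.CF * (P.Klam * U) ^ 2 := by positivity
  have hpow : ((4 : ℝ) ^ (nScales β - (n + 1)))⁻¹ ≤ 4 * ((4 : ℝ) ^ (nScales β - n))⁻¹ := by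
    rcases Nat.lt_or_ge n (nScales β) with h | h
    · have he : nScales β - n = (nScales β - (n + 1)) + 1 := by omega
      rw [he, pow_succ, mul_inv]
      have h4 : (0 : ℝ) < (4 : ℝ) ^ (nScales β - (n + 1)) := by positivity
      field_simp
      exact le_rfl
    · have h1 : nScales β - n = 0 := by omega
      have h2 : nScales β - (n + 1) = 0 := by omega
      rw [h1, h2]; norm_num
  calc G.CF * (P.Klam * U) ^ 2 * ((4 : ℝ) ^ (nScales β - (n + 1)))⁻¹
      ≤ G.CF * (P.Klam * U) ^ 2 * (4 * ((4 : ℝ) ^ (nScales β - n))⁻¹) := mul_le_mul_of_nonneg_left hpow hc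
    _ = 4 * (G.CF * (P.Klam * U) ^ 2 * ((4 : ℝ) ^ (nScales β - n))⁻¹) := by ring

/-- Past the last scale the thermal term is constant: `nScales β ≤ n ⇒ thermalBar … (n+1) = thermalBar … n`. -/
theorem thermalBar_succ_eq_of_le {G : GeoConsts} (P : SplitConsts) (U β : ℝ) {n : ℕ} (hn : nScales β ≤ n) :
    thermalBar G P U β (n + 1) = thermalBar G P U β n := by
  unfold thermalBar
  have h1 : nScales β - n = 0 := by omega
  have h2 : nScales β - (n + 1) = 0 := by omega
  rw [h1, h2]

/-! ## §3 The allowance is strictly decreasing over the head of the ladder -/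

section Decrease

variable {L : ℕ}

/-- **`transferBarAt` at `klEngGeo8` DROPS from `n` to `n+1` (`n ≤ 11`) as soon as the thermal increment is below the cubic decrement**:
`0 < r`, `3·thermalBar klEngGeo8 P U β n < (P.Klam·|U|)³·2^{−(n+1)}` ⇒ `transferBarAt L klEngGeo8 P r β U (n+1) Qm k k′ < transferBarAt L klEngGeo8 P r β U n Qm k k′` at EVERY `Qm k k′`
(the ph gains are flat `= 2^28`, the `1/L` term is constant, the cubic slot halves). -/
theorem transferBarAt_succ_lt_klEngGeo8 {P : SplitConsts} {r β U : ℝ} (hr : 0 < r) {n : ℕ} (hn : n ≤ 11)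
    (hth : 3 * thermalBar klEngGeo8 P U β n < (P.Klam * |U|) ^ 3 * ((2 : ℝ) ^ (n + 1))⁻¹) (Qm k k' : TorusSite 2 L) :
    transferBarAt L klEngGeo8 P r β U (n + 1) Qm k k' < transferBarAt L klEngGeo8 P r β U n Qm k k' := by
  have hCF : 0 ≤ klEngGeo8.CF := by
    rw [klEngGeo8_CF, klEngGeo7_CF, klEngGeo6_CF]
    exact le_trans (by positivity) two_pow_le_klEngGeo5_CF
  have hph : ∀ ρ, klEngGeo8.phGain (n + 1) ρ = klEngGeo8.phGain n ρ := fun ρ => by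
    rw [klEngGeo8_phGain_eq_of_le (by omega) ρ, klEngGeo8_phGain_eq_of_le (by omega) ρ]
  have hthermal := thermalBar_succ_le hCF P U β n
  have hcube : (P.Klam * |U|) ^ 3 * ((2 : ℝ) ^ n)⁻¹ = 2 * ((P.Klam * |U|) ^ 3 * ((2 : ℝ) ^ (n + 1))⁻¹) := by
    rw [pow_succ]; field_simp; ring
  have key : (P.Klam * |U|) ^ 3 * ((2 : ℝ) ^ (n + 1))⁻¹ + thermalBar klEngGeo8 P U β (n + 1) <
      (P.Klam * |U|) ^ 3 * ((2 : ℝ) ^ n)⁻¹ + thermalBar klEngGeo8 P U β n := by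
    rw [hcube]; linarith
  unfold transferBarAt
  rw [hph, hph]
  refine mul_lt_mul_of_pos_left ?_ hr
  linarith

/-- **Past the last scale the drop is UNCONDITIONAL**: `nScales β ≤ n ≤ 11`, `0 < r`, `0 < P.Klam·|U|` ⇒ `transferBarAt … (n+1) < transferBarAt … n` (the thermal term is constant there;
e.g. `β = klBetaMin`: `nScales β = 0`, the allowance drops at the first step). -/
theorem transferBarAt_succ_lt_klEngGeo8_of_nScales_le {P : SplitConsts} {r β U : ℝ} (hr : 0 < r) (hKU : 0 < P.Klam * |U|) {n : ℕ} (hn : n ≤ 11)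
    (hβn : nScales β ≤ n) (Qm k k' : TorusSite 2 L) :
    transferBarAt L klEngGeo8 P r β U (n + 1) Qm k k' < transferBarAt L klEngGeo8 P r β U n Qm k k' := by
  have hph : ∀ ρ, klEngGeo8.phGain (n + 1) ρ = klEngGeo8.phGain n ρ := fun ρ => by
    rw [klEngGeo8_phGain_eq_of_le (by omega) ρ, klEngGeo8_phGain_eq_of_le (by omega) ρ]
  have hthermal : thermalBar klEngGeo8 P U β (n + 1) = thermalBar klEngGeo8 P U β n := thermalBar_succ_eq_of_le P U β hβn
  have hcube : (P.Klam * |U|) ^ 3 * ((2 : ℝ) ^ (n + 1))⁻¹ < (P.Klam * |U|) ^ 3 * ((2 : ℝ) ^ n)⁻¹ := by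
    have h3 : 0 < (P.Klam * |U|) ^ 3 := by positivity
    refine mul_lt_mul_of_pos_left ?_ h3
    exact inv_strictAnti₀ (by positivity) (pow_lt_pow_right₀ (by norm_num) (Nat.lt_succ_self n))
  unfold transferBarAt
  rw [hph, hph, hthermal]
  refine mul_lt_mul_of_pos_left ?_ hr
  linarith

/-- **Consequence for the compose route** (the necessary condition of `pairTransferPinnedAt_succ` negated): under the hypotheses of either lemma above there is NO nonnegative
`E, E_a` with `transferBarAt … n + E + E_a ≤ transferBarAt … (n+1)` at those labels. -/
theorem not_budget_of_transferBarAt_succ_lt {P : SplitConsts} {r β U : ℝ} {n : ℕ} {Qm k k' : TorusSite 2 L}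
    (h : transferBarAt L klEngGeo8 P r β U (n + 1) Qm k k' < transferBarAt L klEngGeo8 P r β U n Qm k k') {E Ea : ℝ} (hE : 0 ≤ E) (hEa : 0 ≤ Ea) :
    ¬ (transferBarAt L klEngGeo8 P r β U n Qm k k' + E + Ea ≤ transferBarAt L klEngGeo8 P r β U (n + 1) Qm k k') := by
  intro hle; linarith

/-- `transferBarAt` is nonnegative at `klEngGeo8` for `0 ≤ r`, `0 ≤ P.Klam` (bracket: gains `≥ 0`, `CF ≥ 0`). -/
theorem transferBarAt_klEngGeo8_nonneg {P : SplitConsts} (hK : 0 ≤ P.Klam) {r : ℝ} (hr : 0 ≤ r) (β U : ℝ) (n : ℕ) (Qm k k' : TorusSite 2 L) :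
    0 ≤ transferBarAt L klEngGeo8 P r β U n Qm k k' := by
  have hCF : 0 ≤ klEngGeo8.CF := by
    rw [klEngGeo8_CF, klEngGeo7_CF, klEngGeo6_CF]
    exact le_trans (by positivity) two_pow_le_klEngGeo5_CF
  have hph : ∀ n ρ, 0 ≤ klEngGeo8.phGain n ρ := fun n ρ => by
    rw [klEngGeo8_phGain, klEngGeo7_phGain, klEngGeo6_phGain, klEngGeo5_phGain_apply]
    exact mul_nonneg (by positivity) (klgp_phGainOf_nonneg (by norm_num) (by norm_num) (by norm_num) (by norm_num) (by norm_num)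
      (by norm_num [klE0]) _ _ (le_max_right _ _))
  exact transferBarAt_nonneg hph hCF hK hr β U n Qm k k'

/-- **The `2·T_{n−1} ≤ T_n` form is refuted too** (k3c1-p1's (A4) `two_mul_transferBarAt_pred_gt`, folded here per plan g20 (R54g)): whenever the allowance drops from `n` to `n+1`
(either lemma above) and `0 ≤ r`, `0 ≤ P.Klam`, then `transferBarAt … (n+1) < 2·transferBarAt … n` — the composition of the history member AND the step-3-built plain step
(each paying `≥ transferBarAt n`) cannot fit under `transferBarAt (n+1)`. -/
theorem transferBarAt_succ_lt_two_mul {P : SplitConsts} (hK : 0 ≤ P.Klam) {r β U : ℝ} (hr : 0 ≤ r) {n : ℕ} {Qm k k' : TorusSite 2 L}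
    (h : transferBarAt L klEngGeo8 P r β U (n + 1) Qm k k' < transferBarAt L klEngGeo8 P r β U n Qm k k') :
    transferBarAt L klEngGeo8 P r β U (n + 1) Qm k k' < 2 * transferBarAt L klEngGeo8 P r β U n Qm k k' := by
  have h0 := transferBarAt_klEngGeo8_nonneg (L := L) hK hr β U n Qm k k'
  linarith

end Decrease

end Summit.HubbardSuperconductivity.HubbardSuperconductivity.Theorems.KLRegimeSplit

end
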